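import Summits.BirchSwinnertonDyer.BirchSwinnertonDyer.Theses.KolyvaginRankRigidityAtTwo
import Summits.BirchSwinnertonDyer.BirchSwinnertonDyer.Theorems.KolyvaginRankRigidityAtTwoSwapInductionLossyTest
import Summits.BirchSwinnertonDyer.BirchSwinnertonDyer.Theorems.KolyvaginRankRigidityAtTwoKolyvaginCorankLowerBoundAtTwoThetaGlobalOrderLevelUp
import Summits.BirchSwinnertonDyer.BirchSwinnertonDyer.Theorems.KolyvaginRankRigidityAtTwoNoTwoTorsionOverK
import Summits.BirchSwinnertonDyer.BirchSwinnertonDyer.Theorems.KolyvaginRankRigidityAtTwoLevelTriangularSystem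
import Summits.BirchSwinnertonDyer.BirchSwinnertonDyer.Theorems.KolyvaginRankRigidityAtTwoKolyvaginCorankLowerBoundAtTwoConjSign
import Summits.BirchSwinnertonDyer.BirchSwinnertonDyer.Theorems.KolyvaginRankRigidityAtTwoKolyvaginCorankLowerBoundAtTwoLocalTrivialAtConductor
import Summits.BirchSwinnertonDyer.BirchSwinnertonDyer.Theorems.KolyvaginRankRigidityAtTwoKolyvaginCorankLowerBoundAtTwoSelmerAwayFromConductor
import Summits.BirchSwinnertonDyer.BirchSwinnertonDyer.Theorems.KolyvaginRankRigidityAtTwoKolyvaginCorankLowerBoundAtTwoMarginChebotarevOneClassIndexAtTwo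
import Summits.BirchSwinnertonDyer.BirchSwinnertonDyer.Theorems.KolyvaginRankRigidityAtTwoKolyvaginCorankLowerBoundAtTwoMarginLocalOrderLevelUpAtTwo
import Summits.BirchSwinnertonDyer.BirchSwinnertonDyer.Theorems.GenusKolyvaginAtTwoKolyvaginRelationAtTwo
import Literature.NumberTheory.EllipticCurves.ArtinFormalismQuadraticLocalProofs
import Literature.NumberTheory.EllipticCurves.HeegnerPointsOfConductorOneGaloisConjProofs
import Literature.NumberTheory.EllipticCurves.BSDSelmerPConverseYanZhuKolyvaginSystemProofs
import Literature.NumberTheory.EllipticCurves.LeadingTermProofs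
import Literature.NumberTheory.EllipticCurves.SelmerCorankHolds
import Literature.NumberTheory.EllipticCurves.MordellWeilTheoremProofs
import HarnessLib

/-!
# Crux V2♭∞ `KolyvaginCorankLowerBoundAtTwoRich` (stmt-BirchSwinnertonDyer-27984; line `kolyvagin_depth_split`):
# the corank lower bound at `2` from a RICH seed — BY NAME, modulo the LOSSY prime swap S1L and Gross 1991 Prop. 3.7 (2)

Width seat krr2-p2 g8 under lead krr2-p1 g8 (route `KolyvaginRankRigidityAtTwo`). This is the lead's ∞-skeleton
`Cruxes/KolyvaginCorankLowerBoundAtTwo/Lines/kolyvagin_depth_split_rich.lean` (g7) with every `sorry` gone: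
* target = the ROUTE decl `Theses.KolyvaginRankRigidityAtTwo.KolyvaginCorankLowerBoundAtTwoRich` (pen g7, rev 26,
  text verbatim from `RICH_RESTATEMENT.lean`), not a local copy;
* S1L (`stub_primeSwapAtTwoLossy`, Kolyvagin's prime swap at `2` with a constant loss `c₂` per swap) enters as
  the DISPLAYED hypothesis `hS1L`, its registered text verbatim — the lead's `primeSwapAtTwoLossy_of_namedFacts`
  (hybrid-transverse frame, P4/P5/P6/P7/P8 landed, Poitou–Tate for THE canonical local invariants a tree theorem
  `InputsPoitouTateSelmer.poitouTate_selmerStructure_duality_conj_holds`) discharges it from `h37`;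
* S3 := the landed `stub_localOrderLevelUpAtTwo` (p621941); T1 := the landed
  `stub_localTrivialAtConductor_of_kolyvaginRelationAtTwo` (p612374) at Q2 `KolyvaginRelationAtTwo`, itself the
  landed `GenusExact.kolyvaginRelationAtTwo_of_frobeniusCongruence h37` (Gross 1991 Prop. 3.7 (2), image-free);
* S2, S4, T2, T3, the lossy swap induction `windowsRich_of_lossySwapTest` (p623984) and
  `lowerBound_of_levelTriangularSystems` (p610758) are landed and imported.
Structure: depth `0` (`depthZero_rich`, Mordell–Weil road) · depth `ν ≥ 1` (`posDepth_rich_of_lossySwap`) · glue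
(`exists_uniform_theta_k_below`, `kolyvaginCorankLowerBoundAtTwoRich_of_lossySwap`).
HONEST FRAMING: CONDITIONAL on `h37 : GrossLMS1991.prop37_2_frobeniusCongruence` (a published theorem, cite-only in
the tree) and on `hS1L` (the lossy swap, beyond print at `2`, being assembled by the lead); nothing here proves
V2♭∞ unconditionally, and the Birch–Swinnerton-Dyer conjecture is NOT proved by any of this.
References: Kolyvagin, Math. Ann. 291 (1991) §2 Thm. 2.2; McCallum, LMS 153 (1991) §5 Prop. 5.2; Gross, LMS 153
(1991) Prop. 3.7 (2), §4; W. Zhang, Camb. J. Math. 2 (2014) Lemma 8.4.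
-/

set_option autoImplicit false
-- the Theorems namespace of this sub repeats the summit name by design (D-0017 nested layout)
set_option linter.dupNamespace false

noncomputable section

open scoped Classical

open WeierstrassCurve Literature.NumberTheory.EllipticCurves
  Literature.NumberTheory.EllipticCurves.ModularForms NumberField IsDedekindDomain
open Summit.BirchSwinnertonDyer.BirchSwinnertonDyer.Theses.KolyvaginRankRigidityAtTwo
open Literature.NumberTheory.EllipticCurves.GrossLMS1991 (prop37_2_frobeniusCongruence)

namespace Summit.BirchSwinnertonDyer.BirchSwinnertonDyer.Theorems.KolyvaginLowerBoundAtTwo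

/-! ## Depth zero (no minimality needed) -/

/-- **Depth `ν = 0`** (no minimality needed): a non-zero class `c_M(1) ≠ 0` forces `P(1) = y_K` to have infinite
order, so `1 ≤ rank E(K) = rank E(ℚ) + rank E^{(d_K)}(ℚ) ≤ c + c'` (Mordell–Weil road; the lead's `depthZeroMargin`).
[cite: GrossLMS1991, §4 (4.1) and Prop. 4.7 (1)] [cite: Greenberg1999LNM, §1 pp. 53–57] -/
theorem depthZero_rich (W : WeierstrassCurve ℚ) [W.IsElliptic] [W.IsGloballyMinimal]
    (K : Type) [Field K] [NumberField K] (hK : IsImaginaryQuadratic K) [NeZero (W.conductorNorm ℤ)]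
    (hHN : SatisfiesHeegnerHypothesis (W.conductorNorm ℤ) K)
    (Dt : ModularParametrizationData W (W.conductorNorm ℤ)) (β : ℤ) (ι : K →+* ℂ) (n : ℕ)
    (d : KolyvaginHeegnerData Dt β ι n) (M : ℕ)
    (hn : KolyvaginDescent.KolSupp (Zhang2014.IsKolyvaginPrime (W.conductorNorm ℤ) W K 2) n)
    (hne : d.kolyvaginClass Nat.prime_two M ≠ 0) (hν : n.primeFactors.card = 0) :
    n.primeFactors.card + 1 ≤ W.selmerCorank 2 ∨
      n.primeFactors.card + 1 ≤ (W.quadraticTwist (NumberField.discr K : ℚ)).selmerCorank 2 := by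
  -- `n` is square-free with no prime factor: `n = 1`
  have hn1 : n = 1 := by
    rw [Finset.card_eq_zero, Nat.primeFactors_eq_empty] at hν
    rcases hν with h0 | h1
    · exact absurd (h0 ▸ hn.1) not_squarefree_zero
    · exact h1
  subst hn1
  rw [hν]
  haveI : Fact (Nat.Prime 2) := ⟨Nat.prime_two⟩
  -- `c_M(1) ≠ 0` forces `P(1)` to have infinite order (Gross 1991, Prop. 4.7 (1))
  have hnt : ¬ IsOfFinAddOrder d.derivedPoint := fun hfin ↦
    hne (heegnerSystem_kolyvaginClass_eq_zero_of_isOfFinAddOrder d Nat.prime_two M hfin)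
  -- `P(1) = Tr_{K[1]/K} y(1)` descends to `P₀ ∈ E(K)` (reciprocity at conductor `1` is a theorem)
  obtain ⟨P₀, -, hP₀⟩ := heegnerSystem_exists_isHeegnerPoint_map_eq_derivedPoint_one
    (heegnerPointOfConductor_one_galoisConj_holds _ W K) hK hHN d
  have hnt₀ : ¬ IsOfFinAddOrder P₀ := fun h ↦ hnt (hP₀ ▸
    (WeierstrassCurve.Affine.Point.map (W' := W)
      (algebraMap K (ringClassField K ι 1)).toRatAlgHom).isOfFinAddOrder h)
  -- Mordell–Weil: `1 ≤ rank E(K) = rank E(ℚ) + rank E^{(d_K)}(ℚ)`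
  haveI : (W.baseChange K).IsElliptic := by rw [baseChange]; infer_instance
  have hge : 1 ≤ (W.baseChange K).mordellWeilRank :=
    one_le_mordellWeilRank_of_not_isOfFinAddOrder _ (W.baseChange K).module_finite_point_holds hnt₀
  have hrk := mordellWeilRank_baseChange_quadratic_holds W K hK.1
  -- `corank Sel_{2^∞} = rank + corank Ш[2^∞]` for `E` and for `E^{(d_K)}`
  have hd : (NumberField.discr K : ℚ) ≠ 0 := by exact_mod_cast NumberField.discr_ne_zero K
  haveI := W.isElliptic_quadraticTwist hd
  have hQ := W.selmerCorank_eq_mordellWeilRank_add_holds 2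
  have hT := (W.quadraticTwist (NumberField.discr K : ℚ)).selmerCorank_eq_mordellWeilRank_add_holds 2
  omega

/-! ## Positive depth (from S1L displayed, S2–S4, T1 ⇐ Q2 ⇐ Gross 3.7 (2), T2, T3, the lossy swap induction and
the triangular systems — all landed) -/

/-- **LOWER bound at a RICH depth `ν ≥ 1` with `(θ, k)`-minimality below it** — Kolyvagin's Thm. 2.2 at `2`
assembled on one frame: windows at every level from the LOSSY prime swap `hswap` (output exponent `j − c₂`),
Čebotarev-with-index `hcheb` (S2), the level-ups `hlocUp` (S3) / `hglobUp` (S4) through the landed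
`windowsRich_of_lossySwapTest` (p623984); then the triangular system of Selmer eigen-classes `η_i = 2^t c_M(n_i)`
(T1 ⇐ Q2 ⇐ `h37` at the window primes, T2 elsewhere, T3 for the sign) read by
`lowerBound_of_levelTriangularSystems` (p610758). The lead's `posDepthRich` with T1 wired to Gross 3.7 (2).
[cite: Kolyvagin1991MathAnn, §2 Thm. 2.2–2.3] [cite: WZhang2014, Lemma 8.4] [cite: GrossLMS1991, Prop. 3.7 (2)] -/
theorem posDepth_rich_of_lossySwap (h37 : prop37_2_frobeniusCongruence) (W : WeierstrassCurve ℚ) [W.IsElliptic]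
    [W.IsGloballyMinimal] (hCM : ¬ W.HasCM)
    (hred : Rank1Residual.GoodOrd W 2 ∨ Rank1Residual.Mult W 2)
    (hsur : ∀ m : ℕ, W.HasSurjectiveModNGaloisRep (2 ^ m : ℕ))
    (K : Type) [Field K] [NumberField K] (hK : IsImaginaryQuadratic K) (hne3 : NumberField.discr K ≠ -3)
    (hne4 : NumberField.discr K ≠ -4) (h2d : ¬ ((2 : ℤ) ∣ NumberField.discr K))
    [NeZero (W.conductorNorm ℤ)] (hHN : SatisfiesHeegnerHypothesis (W.conductorNorm ℤ) K)
    (Dt : ModularParametrizationData W (W.conductorNorm ℤ)) (β : ℤ) (ι : K →+* ℂ) (c₀ c₁ c₂ : ℕ)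
    (hswap :
        ∀ (M I : ℕ) (T : Finset ℕ) (a : ℕ)
          (dat : KolyvaginHeegnerData Dt β ι (∏ p ∈ T, p)) (j : ℕ) (X : Finset ℕ),
          1 ≤ M → M + 1 ≤ I →
          (∀ p ∈ T, Zhang2014.IsKolyvaginPrime (W.conductorNorm ℤ) W K 2 p ∧
            M + 1 ≤ Zhang2014.kolyvaginIndex W 2 p) →
          a ∈ T → M + c₀ ≤ 2 * j →
          (∀ X' : Finset ℕ, ∃ q : ℕ, q ∉ X' ∧ Zhang2014.IsKolyvaginPrime (W.conductorNorm ℤ) W K 2 q ∧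
            I ≤ Zhang2014.kolyvaginIndex W 2 q ∧
            ∃ v : HeightOneSpectrum (𝓞 K), ((q : ℕ) : 𝓞 K) ∈ v.asIdeal ∧
              ((2 ^ j : ℕ) : ℤ) • dat.kolyvaginClass Nat.prime_two M ∉
                (W.baseChange K).torsionLocalKer (v.adicCompletion K) ((2 ^ M : ℕ) : ℤ)) →
          ∃ ℓ : ℕ, ℓ ∉ X ∧ ℓ ∉ T ∧ Zhang2014.IsKolyvaginPrime (W.conductorNorm ℤ) W K 2 ℓ ∧
            I ≤ Zhang2014.kolyvaginIndex W 2 ℓ ∧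
            (∃ v : HeightOneSpectrum (𝓞 K), ((ℓ : ℕ) : 𝓞 K) ∈ v.asIdeal ∧
              ((2 ^ (j - c₂) : ℕ) : ℤ) • dat.kolyvaginClass Nat.prime_two M ∉
                (W.baseChange K).torsionLocalKer (v.adicCompletion K) ((2 ^ M : ℕ) : ℤ)) ∧
            ∃ dat' : KolyvaginHeegnerData Dt β ι (∏ p ∈ insert ℓ (T.erase a), p),
              (∀ X' : Finset ℕ, ∃ q : ℕ, q ∉ X' ∧ Zhang2014.IsKolyvaginPrime (W.conductorNorm ℤ) W K 2 q ∧
                I ≤ Zhang2014.kolyvaginIndex W 2 q ∧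
                ∃ v : HeightOneSpectrum (𝓞 K), ((q : ℕ) : 𝓞 K) ∈ v.asIdeal ∧
                  ((2 ^ (j - c₂) : ℕ) : ℤ) • dat'.kolyvaginClass Nat.prime_two M ∉
                    (W.baseChange K).torsionLocalKer (v.adicCompletion K) ((2 ^ M : ℕ) : ℤ)))
    (hcheb :
        ∀ (n : ℕ) (dat : KolyvaginHeegnerData Dt β ι n) (M m I : ℕ),
          KolyvaginDescent.KolSupp (Zhang2014.IsKolyvaginPrime (W.conductorNorm ℤ) W K 2) n →
          1 ≤ M → (M : ℕ∞) ≤ Zhang2014.levelIndex W 2 n → M ≤ I → c₁ ≤ m →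
          ((2 ^ m : ℕ) : ℤ) • dat.kolyvaginClass Nat.prime_two M ≠ 0 →
          (∀ X' : Finset ℕ, ∃ q : ℕ, q ∉ X' ∧ Zhang2014.IsKolyvaginPrime (W.conductorNorm ℤ) W K 2 q ∧
            I ≤ Zhang2014.kolyvaginIndex W 2 q ∧
            ∃ v : HeightOneSpectrum (𝓞 K), ((q : ℕ) : 𝓞 K) ∈ v.asIdeal ∧
              ((2 ^ (m - c₁) : ℕ) : ℤ) • dat.kolyvaginClass Nat.prime_two M ∉
                (W.baseChange K).torsionLocalKer (v.adicCompletion K) ((2 ^ M : ℕ) : ℤ)))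
    (hlocUp :
        ∀ (n : ℕ) (dat : KolyvaginHeegnerData Dt β ι n) (M M' j q : ℕ)
          (v : HeightOneSpectrum (𝓞 K)),
          KolyvaginDescent.KolSupp (Zhang2014.IsKolyvaginPrime (W.conductorNorm ℤ) W K 2) n →
          1 ≤ M → M ≤ M' → (M' : ℕ∞) ≤ Zhang2014.levelIndex W 2 n →
          Zhang2014.IsKolyvaginPrime (W.conductorNorm ℤ) W K 2 q → M' ≤ Zhang2014.kolyvaginIndex W 2 q →
          ¬ q ∣ n → ((q : ℕ) : 𝓞 K) ∈ v.asIdeal →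
          ((2 ^ j : ℕ) : ℤ) • dat.kolyvaginClass Nat.prime_two M ∉
            (W.baseChange K).torsionLocalKer (v.adicCompletion K) ((2 ^ M : ℕ) : ℤ) →
          ((2 ^ (j + (M' - M)) : ℕ) : ℤ) • dat.kolyvaginClass Nat.prime_two M' ∉
            (W.baseChange K).torsionLocalKer (v.adicCompletion K) ((2 ^ M' : ℕ) : ℤ))
    (hglobUp :
        ∀ (n : ℕ) (dat : KolyvaginHeegnerData Dt β ι n) (M M' j : ℕ),
          KolyvaginDescent.KolSupp (Zhang2014.IsKolyvaginPrime (W.conductorNorm ℤ) W K 2) n →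
          1 ≤ M → M ≤ M' → (M' : ℕ∞) ≤ Zhang2014.levelIndex W 2 n →
          ((2 ^ j : ℕ) : ℤ) • dat.kolyvaginClass Nat.prime_two M ≠ 0 →
          ((2 ^ (j + (M' - M)) : ℕ) : ℤ) • dat.kolyvaginClass Nat.prime_two M' ≠ 0) :
    ∀ ν : ℕ, 1 ≤ ν →
      (∀ θ k : ℕ, ∃ (n : ℕ) (d : KolyvaginHeegnerData Dt β ι n) (M : ℕ),
        KolyvaginDescent.KolSupp (Zhang2014.IsKolyvaginPrime (W.conductorNorm ℤ) W K 2) n ∧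
        n.primeFactors.card = ν ∧ 1 ≤ M ∧ ((θ * M + k : ℕ) : ℕ∞) ≤ Zhang2014.levelIndex W 2 n ∧
        d.kolyvaginClass Nat.prime_two M ≠ 0) →
      (∃ θ k : ℕ, ∀ (n' : ℕ) (d' : KolyvaginHeegnerData Dt β ι n') (M' : ℕ),
        KolyvaginDescent.KolSupp (Zhang2014.IsKolyvaginPrime (W.conductorNorm ℤ) W K 2) n' →
        1 ≤ M' → ((θ * M' + k : ℕ) : ℕ∞) ≤ Zhang2014.levelIndex W 2 n' →
        n'.primeFactors.card < ν → d'.kolyvaginClass Nat.prime_two M' = 0) →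
      (ν + 1 ≤ W.selmerCorank 2 ∨ ν + 1 ≤ (W.quadraticTwist (NumberField.discr K : ℚ)).selmerCorank 2) := by
  intro ν hpos hrich hmin
  set N := W.conductorNorm ℤ with hNdef
  haveI : Fact (Nat.Prime 2) := ⟨Nat.prime_two⟩
  -- windows at every level (landed lossy swap induction with a rich seed)
  have hWin := windowsRich_of_lossySwapTest W K Dt β ι c₀ c₁ c₂ hswap hcheb hlocUp hglobUp ν hpos hrich hmin
  -- the quadratic field: `K = ℚ(θ)`, `θ² = d_K`, `σ₀` its non-trivial automorphism
  obtain ⟨θ, hθ, hc⟩ := exists_sq_eq_discr_not_mem_range K hK.1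
  set σ₀ := sigmaQ K hK.1 hθ hc with hσ₀
  have hσ₀1 : σ₀ ≠ 1 := sigmaQ_ne_one K hK.1 hθ hc
  -- the other stubs / landed pieces on this frame
  have hT1 := stub_localTrivialAtConductor_of_kolyvaginRelationAtTwo
    (GenusExact.kolyvaginRelationAtTwo_of_frobeniusCongruence h37) W hCM hred hsur K hK hne3 hne4 h2d hHN Dt β ι
  obtain ⟨t, hT2⟩ :=
    KolyvaginRankRigidity.stub_selmerAwayFromConductor W hCM hred hsur K hK hne3 hne4 h2d hHN Dt β ι
  obtain ⟨f, dd, hνf, hT5⟩ := hWin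
  obtain ⟨ε, hε1, hT3⟩ := stub_conjSign W hCM hred hsur K hK hne3 hne4 h2d hHN Dt β ι σ₀ hσ₀1 f
  -- `E(K)[2] = 0` (landed support `NoTwoTorsionOverK`)
  have htor : AddSubgroup.torsionBy (W.baseChange K).toAffine.Point (2 : ℤ) = ⊥ :=
    KolyvaginRankRigidity.noTwoTorsionOverK_proof W hsur K hK
  -- it suffices to bound by `f + 1 ≥ ν + 1`
  suffices h : f + 1 ≤ W.selmerCorank 2 ∨
      f + 1 ≤ (W.quadraticTwist (NumberField.discr K : ℚ)).selmerCorank 2 by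
    rcases h with h | h
    · exact Or.inl (le_trans (by omega) h)
    · exact Or.inr (le_trans (by omega) h)
  -- the level-`2^M'` triangular systems at depth `f`
  refine lowerBound_of_levelTriangularSystems W K hK.1 hθ hc htor f (dd + t) ε hε1 fun M' ↦ ?_
  rcases Nat.eq_zero_or_pos M' with hM'0 | hM'pos
  · subst hM'0
    obtain ⟨-, -, v₁, -, -⟩ := hT5 1 le_rfl
    refine ⟨fun _ ↦ 0, v₁, fun _ ↦ zero_mem _, fun _ ↦ by rw [map_zero, zsmul_zero],
      fun _ _ _ ↦ zero_mem _, fun _ e he ↦ absurd he (by omega)⟩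
  obtain ⟨S, q, v, dat, hcard, hprimes, hinc, hqv, hvan0, hdiag⟩ := hT5 M' hM'pos
  -- facts on the window conductors
  have hSprime : ∀ i, ∀ p ∈ S i, p.Prime := fun i p hp ↦ (hprimes i p hp).1.1
  have hpf : ∀ i, (∏ p ∈ S i, p).primeFactors = S i := fun i ↦ Nat.primeFactors_prod (hSprime i)
  have hsq : ∀ i, Squarefree (∏ p ∈ S i, p) := fun i ↦ by
    refine Finset.squarefree_prod_of_pairwise_isCoprime (fun a ha b hb hab ↦ ?_)
      fun p hp ↦ (hSprime i p hp).squarefree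
    simp only [← Nat.coprime_iff_isRelPrime]
    exact (Nat.coprime_primes (hSprime i a ha) (hSprime i b hb)).mpr hab
  have hsupp : ∀ i, KolyvaginDescent.KolSupp (Zhang2014.IsKolyvaginPrime N W K 2) (∏ p ∈ S i, p) :=
    fun i ↦ ⟨hsq i, fun p hp ↦ (hprimes i p (by rwa [hpf i] at hp)).1⟩
  have hlev1 : ∀ i, ((M' + 1 : ℕ) : ℕ∞) ≤ Zhang2014.levelIndex W 2 (∏ p ∈ S i, p) := fun i ↦ by
    rw [Zhang2014.natCast_le_levelIndex_iff]
    intro p hp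
    rw [hpf i] at hp
    exact (hprimes i p hp).2
  have hlev : ∀ i, ((M' : ℕ) : ℕ∞) ≤ Zhang2014.levelIndex W 2 (∏ p ∈ S i, p) := fun i ↦
    le_trans (by exact_mod_cast Nat.le_succ M') (hlev1 i)
  -- T1 at every prime `ℓ ∣ n_i` (vanishing of the classes of conductor `n_i/ℓ` supplied by the windows)
  have hloc : ∀ i, ∀ ℓ ∈ S i, ∀ w : HeightOneSpectrum (𝓞 K), ((ℓ : ℕ) : 𝓞 K) ∈ w.asIdeal →
      (dat i).kolyvaginClass Nat.prime_two M' ∈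
        (W.baseChange K).torsionLocalKer (w.adicCompletion K) ((2 ^ M' : ℕ) : ℤ) :=
    fun i ℓ hℓ w hw ↦ hT1 _ (dat i) M' ℓ (hsupp i) hM'pos (hlev1 i) (by rw [hpf i]; exact hℓ)
      (hvan0 i ℓ hℓ) w hw
  -- the classes
  refine ⟨fun i ↦ ((2 ^ t : ℕ) : ℤ) • (dat i).kolyvaginClass Nat.prime_two M', v, ?_, ?_, ?_, ?_⟩
  · -- Selmer
    intro i
    rw [mem_selmerGroup_iff]
    refine ⟨fun w ↦ ?_, fun w ↦ ?_⟩
    · by_cases hw : (((∏ p ∈ S i, p : ℕ) : ℕ) : 𝓞 K) ∈ w.asIdeal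
      · rw [Nat.cast_prod] at hw
        obtain ⟨ℓ, hℓ, hℓw⟩ := Ideal.IsPrime.prod_mem_iff.mp hw
        exact AddSubgroup.zsmul_mem _
          ((W.baseChange K).torsionLocalKer_le_selmerLocalKer _ _ (hloc i ℓ hℓ w hℓw)) _
      · exact hT2 _ (dat i) M' (hsupp i) hM'pos (hlev i) w hw
    · haveI : IsAlgClosed w.Completion := isAlgClosed_of_ringEquiv
        (InfinitePlace.Completion.ringEquivComplexOfIsComplex (hK.2.isComplex w)).symm
      rw [WeierstrassCurve.selmerLocalKer_eq_top_of_isAlgClosed]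
      trivial
  · -- eigen
    intro i
    rw [map_zsmul, hT3 _ (dat i) M' (hsupp i) (by rw [hpf i, hcard i]) hM'pos (hlev i),
      smul_comm]
  · -- triangular
    intro i j hij
    exact AddSubgroup.zsmul_mem _ (hloc i (q j) (hinc i j hij) (v j) (hqv j)) _
  · -- diagonal
    intro i e he hmem
    refine hdiag i (e + t) (by omega) ?_
    rw [pow_add, Nat.cast_mul, ← smul_smul]
    exact hmem

/-! ## Glue -/

/-- Uniform relative margin below a depth: from one `(θ, k)` per smaller depth to one pair for all smaller depths
(strongness is antitone in `(θ, k)`; finite maximum over `ν' < ν`). [folklore] -/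
theorem exists_uniform_theta_k_below {P : ℕ → ℕ → ℕ → Prop}
    (hanti : ∀ ν' θ k θ' k', θ ≤ θ' → k ≤ k' → P ν' θ k → P ν' θ' k') {ν : ℕ}
    (h : ∀ ν' : ℕ, ν' < ν → ∃ θ k : ℕ, P ν' θ k) : ∃ θ k : ℕ, ∀ ν' : ℕ, ν' < ν → P ν' θ k := by
  classical
  choose! θf kf hθk using h
  refine ⟨(Finset.range ν).sup θf, (Finset.range ν).sup kf, fun ν' hν' ↦ ?_⟩
  have hm : ν' ∈ Finset.range ν := Finset.mem_range.mpr hν'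
  exact hanti ν' _ _ _ _ (Finset.le_sup hm) (Finset.le_sup hm) (hθk ν' hν')

/-- **V2♭∞ `KolyvaginCorankLowerBoundAtTwoRich` (stmt-BirchSwinnertonDyer-27984, the ROUTE decl) from the LOSSY prime swap
S1L (`hS1L`, the text of the registered-to-be stub `stub_primeSwapAtTwoLossy` VERBATIM) and Gross 1991 Prop. 3.7 (2)
(`h37`, feeding T1 through Q2).** Every other piece is a landed theorem: S2 `stub_chebotarevOneClassIndexAtTwo`
(p621465), S3 `stub_localOrderLevelUpAtTwo` (p621941), S4 `stub_globalOrderLevelUpAtTwo` (p621416), T2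
`stub_selmerAwayFromConductor` (p612348), T3 `stub_conjSign` (p611883), the lossy swap induction
`windowsRich_of_lossySwapTest` (p623984) and the triangular systems `lowerBound_of_levelTriangularSystems` (p610758).
CONDITIONAL on `h37` and `hS1L` (D-0014); the lead's `primeSwapAtTwoLossy_of_namedFacts h37 : ‹hS1L›` makes it
conditional on `h37` alone. BSD is not proved by this. [cite: Kolyvagin1991MathAnn, §2 Thm. 2.2, p. 257, p. 259 (2.1)]
[cite: McCallumLMS1991, §5 Prop. 5.2] [cite: GrossLMS1991, Prop. 3.7 (2)] -/
theorem kolyvaginCorankLowerBoundAtTwoRich_of_lossySwap (h37 : prop37_2_frobeniusCongruence)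
    (hS1L :
    ∀ (W : WeierstrassCurve ℚ) [W.IsElliptic] [W.IsGloballyMinimal], ¬ W.HasCM →
      (Rank1Residual.GoodOrd W 2 ∨ Rank1Residual.Mult W 2) →
      (∀ m : ℕ, W.HasSurjectiveModNGaloisRep (2 ^ m : ℕ)) →
      ∀ (K : Type) [Field K] [NumberField K], IsImaginaryQuadratic K → NumberField.discr K ≠ -3 →
      NumberField.discr K ≠ -4 → ¬ ((2 : ℤ) ∣ NumberField.discr K) → ∀ [NeZero (W.conductorNorm ℤ)],
      SatisfiesHeegnerHypothesis (W.conductorNorm ℤ) K →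
      ∃ c₀ c₂ : ℕ, ∀ (Dt : ModularParametrizationData W (W.conductorNorm ℤ)) (β : ℤ) (ι : K →+* ℂ),
        ∀ (M I : ℕ) (T : Finset ℕ) (a : ℕ)
          (dat : KolyvaginHeegnerData Dt β ι (∏ p ∈ T, p)) (j : ℕ) (X : Finset ℕ),
          1 ≤ M → M + 1 ≤ I →
          (∀ p ∈ T, Zhang2014.IsKolyvaginPrime (W.conductorNorm ℤ) W K 2 p ∧
            M + 1 ≤ Zhang2014.kolyvaginIndex W 2 p) →
          a ∈ T → M + c₀ ≤ 2 * j →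
          (∀ X' : Finset ℕ, ∃ q : ℕ, q ∉ X' ∧ Zhang2014.IsKolyvaginPrime (W.conductorNorm ℤ) W K 2 q ∧
            I ≤ Zhang2014.kolyvaginIndex W 2 q ∧
            ∃ v : HeightOneSpectrum (𝓞 K), ((q : ℕ) : 𝓞 K) ∈ v.asIdeal ∧
              ((2 ^ j : ℕ) : ℤ) • dat.kolyvaginClass Nat.prime_two M ∉
                (W.baseChange K).torsionLocalKer (v.adicCompletion K) ((2 ^ M : ℕ) : ℤ)) →
          ∃ ℓ : ℕ, ℓ ∉ X ∧ ℓ ∉ T ∧ Zhang2014.IsKolyvaginPrime (W.conductorNorm ℤ) W K 2 ℓ ∧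
            I ≤ Zhang2014.kolyvaginIndex W 2 ℓ ∧
            (∃ v : HeightOneSpectrum (𝓞 K), ((ℓ : ℕ) : 𝓞 K) ∈ v.asIdeal ∧
              ((2 ^ (j - c₂) : ℕ) : ℤ) • dat.kolyvaginClass Nat.prime_two M ∉
                (W.baseChange K).torsionLocalKer (v.adicCompletion K) ((2 ^ M : ℕ) : ℤ)) ∧
            ∃ dat' : KolyvaginHeegnerData Dt β ι (∏ p ∈ insert ℓ (T.erase a), p),
              (∀ X' : Finset ℕ, ∃ q : ℕ, q ∉ X' ∧ Zhang2014.IsKolyvaginPrime (W.conductorNorm ℤ) W K 2 q ∧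
                I ≤ Zhang2014.kolyvaginIndex W 2 q ∧
                ∃ v : HeightOneSpectrum (𝓞 K), ((q : ℕ) : 𝓞 K) ∈ v.asIdeal ∧
                  ((2 ^ (j - c₂) : ℕ) : ℤ) • dat'.kolyvaginClass Nat.prime_two M ∉
                    (W.baseChange K).torsionLocalKer (v.adicCompletion K) ((2 ^ M : ℕ) : ℤ))) :
    KolyvaginCorankLowerBoundAtTwoRich := by
  intro W _ _ hCM hred hsur K _ _ hK hne3 hne4 h2d _ hHN Dt β ι ν hrich hbelow
  obtain ⟨c₀, c₂, hS1⟩ := hS1L W hCM hred hsur K hK hne3 hne4 h2d hHN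
  obtain ⟨c₁, hS2⟩ := stub_chebotarevOneClassIndexAtTwo W hCM hred hsur K hK hne3 hne4 h2d hHN
  rcases Nat.eq_zero_or_pos ν with h0 | hpos
  · subst h0
    obtain ⟨n, d, M, hn, hcard, -, -, hne⟩ := hrich 0 0
    have h := depthZero_rich W K hK hHN Dt β ι n d M hn hne hcard
    rwa [hcard] at h
  · -- one `(θ, k)` for all depths below `ν`
    obtain ⟨θ, k, hθk⟩ := exists_uniform_theta_k_below
      (P := fun ν' θ k ↦ ∀ (n' : ℕ) (d' : KolyvaginHeegnerData Dt β ι n') (M' : ℕ),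
        KolyvaginDescent.KolSupp (Zhang2014.IsKolyvaginPrime (W.conductorNorm ℤ) W K 2) n' →
        1 ≤ M' → ((θ * M' + k : ℕ) : ℕ∞) ≤ Zhang2014.levelIndex W 2 n' →
        n'.primeFactors.card = ν' → d'.kolyvaginClass Nat.prime_two M' = 0)
      (fun ν' θ k θ' k' hθ hk h n' d' M' hn' hM' hle hcard ↦ h n' d' M' hn' hM'
        (le_trans (by exact_mod_cast (by nlinarith : θ * M' + k ≤ θ' * M' + k')) hle) hcard) hbelow
    exact posDepth_rich_of_lossySwap h37 W hCM hred hsur K hK hne3 hne4 h2d hHN Dt β ι c₀ c₁ c₂ (hS1 Dt β ι)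
      (hS2 Dt β ι)
      (stub_localOrderLevelUpAtTwo W hCM hred hsur K hK hne3 hne4 h2d hHN Dt β ι)
      (stub_globalOrderLevelUpAtTwo W hCM hred hsur K hK hne3 hne4 h2d hHN Dt β ι)
      ν hpos hrich ⟨θ, k, fun n' d' M' hn' hM' hle hlt ↦ hθk _ hlt n' d' M' hn' hM' hle rfl⟩

end Summit.BirchSwinnertonDyer.BirchSwinnertonDyer.Theorems.KolyvaginLowerBoundAtTwo

end
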